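import Summits.BirchSwinnertonDyer.BirchSwinnertonDyer.Theorems.BiquadraticEisensteinDescentHeegnerTwistCouplingInSupplyQuarticTwistDescentDual
import HarnessLib

set_option linter.dupNamespace false -- `Summit.BirchSwinnertonDyer.BirchSwinnertonDyer.Theorems.…` (summit = sub)
set_option autoImplicit false

/-!
# Crux `HeegnerTwistCouplingInSupply` (stmt-BirchSwinnertonDyer-21381) — the QUARTIC `j = 1728` corner with a SYMBOLIC PARTNER, I:
# `S(0, −r²pq²) = {1, −p}` for a partner prime `r ≡ 5 (mod 8)` with `(r/p) = +1` and `p ∉ 𝔽_r^{×4}`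

Route `BiquadraticEisensteinDescent` (cell `pub/bsd-wall`, width seat `bsd-wall-cm-bed-w4` g13; `--supports` 21381, helper;
LEAD-VERDICT-ibd-p1-g11 §4 (ii)). Generalises `…QuarticTwistDescent` (partner `5`) to an arbitrary PARTNER prime `r ≡ 5 (mod 8)`: for
the corner `W_p⁻ : y² = x³ − p·x` (`p ≡ 7 (mod 8)`) twisted by `d = −r·q` (`q ≡ 3 (mod 8)` prime, `(q/p) = −1`, `(r/p) = +1`, so that
`d ≡ 1 (mod 8)` and `(d/p) = +1`), the twist is `W^{(d)} : y² = x³ − r²pq²·x` and the descent via `2`-isogeny on the divisors of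
`b = −r²pq²` gives ★ `mem_selmer_neg_iff`: **`S(0, −r²pq²) = {1, −p}` provided `p` is not a fourth power modulo `r`** (it is a square,
`(p/r) = (r/p) = +1`). Numerically (crux memo QUARTIC-CORNER-w4g13.md): this and the dual side are sharp IFF `p ∉ 𝔽_r^{×4}`, for
`r ∈ {5, 13, 29, 37, 53, 61}` without exception; the partners are independent (CRT), so the rungs cover `1 − (3/4)^k` of `p ≡ 7 (8)`.

Kills (uniform in `r`, no case split on this side): `1`, `−p` are the images of `O`, `T`; `−1, −r, p, rp, q, rq, −pq, −rpq` die at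
`p` (non-residues `−1, −r, −r²q², −rq², q, rq, r²q, rq` — here `(2/p) = (r/p) = +1`, `(−1/p) = (q/p) = −1`); `−rq, rpq` die at `r`
(reduced forms `∓q·(x⁴ − p·y⁴)`: anisotropic iff `p ∉ 𝔽_r^{×4}`); `r, −rp, −q, pq` die at `2` (no solutions mod `8`: `r ≡ 5`, `p ≡ 7`,
`q ≡ 3`). Tools: `…QuarticTwistLocal`. HONEST FRAMING: a typed sub-corner on one CM family (measure zero in «all CM `W`»); the crux
(residual C⁺) is untouched; BSD is not proved by any of this. THEOREMS ONLY. Supports stmt-BirchSwinnertonDyer-21381.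
-/

noncomputable section

open scoped Classical

namespace Summit.BirchSwinnertonDyer.BirchSwinnertonDyer.Theorems.BiquadraticEisensteinDescentHeegnerTwistCouplingInSupplyQuarticPartnerDescent

open Literature.NumberTheory.EllipticCurves Literature.NumberTheory.EllipticCurves.XCubeAddPX
  Summit.BirchSwinnertonDyer.BirchSwinnertonDyer.Theorems.BiquadraticEisensteinDescentHeegnerTwistCouplingInSupplyQuarticTwistLocal
  Summit.BirchSwinnertonDyer.BirchSwinnertonDyer.Theorems.BiquadraticEisensteinDescentHeegnerTwistCouplingInSupplyQuarticTwistDescent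

/-! ## §1 Residues modulo `p` and anisotropy modulo the partner `r` -/

section Residues

variable {p q r : ℕ} [hp : Fact p.Prime] [hq : Fact q.Prime] [hr : Fact r.Prime]

omit hq hr in
/-- For `p ≡ 7 (mod 8)`, `(r/p) = +1`, `(q/p) = −1`: the integers `−r, rq, r²q, −r²q², −rq², 4r²q, 4rq, 2q, 2r²q, 2rq`
are non-residues mod `p` (and `−1, q`). [folklore] -/
theorem nonresidues_mod_p_partner (hp8 : p % 8 = 7) (hqp : q ≠ p) (hrp : r ≠ p) (hQ : q.Prime) (hR : r.Prime)
    (hnq : ¬ IsSquare ((q : ℤ) : ZMod p)) (hsr : IsSquare ((r : ℤ) : ZMod p)) :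
    ¬ IsSquare (((-(r : ℤ)) : ℤ) : ZMod p) ∧ ¬ IsSquare (((r * q : ℤ)) : ZMod p) ∧
    ¬ IsSquare (((r ^ 2 * q : ℤ)) : ZMod p) ∧ ¬ IsSquare (((-(r ^ 2 * q ^ 2) : ℤ)) : ZMod p) ∧
    ¬ IsSquare (((-(r * q ^ 2) : ℤ)) : ZMod p) ∧ ¬ IsSquare (((4 * r ^ 2 * q : ℤ)) : ZMod p) ∧
    ¬ IsSquare (((4 * r * q : ℤ)) : ZMod p) ∧ ¬ IsSquare (((2 * q : ℤ)) : ZMod p) ∧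
    ¬ IsSquare (((2 * r ^ 2 * q : ℤ)) : ZMod p) ∧ ¬ IsSquare (((2 * r * q : ℤ)) : ZMod p) := by
  have hP := hp.out
  have hm1 := not_isSquare_neg_one (p := p) (by omega)
  have h2 := isSquare_two (p := p) hp8
  have hq0 : ((q : ℤ) : ZMod p) ≠ 0 := by
    intro h0
    have : (p : ℤ) ∣ q := (ZMod.intCast_zmod_eq_zero_iff_dvd q p).mp h0
    have : p ∣ q := by exact_mod_cast this
    exact hqp ((Nat.prime_dvd_prime_iff_eq hP hQ).mp this).symm
  have hr0 : ((r : ℤ) : ZMod p) ≠ 0 := by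
    intro h0
    have : (p : ℤ) ∣ r := (ZMod.intCast_zmod_eq_zero_iff_dvd r p).mp h0
    have : p ∣ r := by exact_mod_cast this
    exact hrp ((Nat.prime_dvd_prime_iff_eq hP hR).mp this).symm
  have h20 : ((2 : ℤ) : ZMod p) ≠ 0 := by
    intro h0
    have : (p : ℤ) ∣ 2 := (ZMod.intCast_zmod_eq_zero_iff_dvd 2 p).mp h0
    have h' : p ∣ 2 := by exact_mod_cast this
    rcases (Nat.dvd_prime Nat.prime_two).mp h' with h | h
    · exact hP.one_lt.ne' h
    · omega
  have hsq : ∀ x : ZMod p, IsSquare (x ^ 2) := fun x => ⟨x, sq x⟩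
  have hq2 : IsSquare (((q : ℤ) : ZMod p) ^ 2) := hsq _
  have hq20 : (((q : ℤ) : ZMod p) ^ 2) ≠ 0 := pow_ne_zero 2 hq0
  have hr2 : IsSquare (((r : ℤ) : ZMod p) ^ 2) := hsq _
  have hr20 : (((r : ℤ) : ZMod p) ^ 2) ≠ 0 := pow_ne_zero 2 hr0
  have h4 : IsSquare ((4 : ℤ) : ZMod p) := ⟨2, by push_cast; norm_num⟩
  have h40 : ((4 : ℤ) : ZMod p) ≠ 0 := by
    have : ((4 : ℤ) : ZMod p) = ((2 : ℤ) : ZMod p) ^ 2 := by push_cast; norm_num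
    rw [this]; exact pow_ne_zero 2 h20
  -- the basic non-residues `−r` and `rq`
  have hnr : ¬ IsSquare (((-(r : ℤ)) : ℤ) : ZMod p) := by
    rw [show (((-(r : ℤ)) : ℤ) : ZMod p) = ((-1 : ℤ) : ZMod p) * ((r : ℤ) : ZMod p) by push_cast; ring]
    exact not_isSquare_mul_of_isSquare hm1 hsr hr0
  have hrq : ¬ IsSquare (((r * q : ℤ)) : ZMod p) := by
    rw [show ((r * q : ℤ) : ZMod p) = ((q : ℤ) : ZMod p) * ((r : ℤ) : ZMod p) by push_cast; ring]
    exact not_isSquare_mul_of_isSquare hnq hsr hr0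
  refine ⟨hnr, hrq, ?_, ?_, ?_, ?_, ?_, ?_, ?_, ?_⟩
  · rw [show ((r ^ 2 * q : ℤ) : ZMod p) = ((q : ℤ) : ZMod p) * ((r : ℤ) : ZMod p) ^ 2 by push_cast; ring]
    exact not_isSquare_mul_of_isSquare hnq hr2 hr20
  · rw [show ((-(r ^ 2 * q ^ 2) : ℤ) : ZMod p) = ((-1 : ℤ) : ZMod p) * ((r : ℤ) : ZMod p) ^ 2 * ((q : ℤ) : ZMod p) ^ 2 by
      push_cast; ring]
    exact not_isSquare_mul_of_isSquare (not_isSquare_mul_of_isSquare hm1 hr2 hr20) hq2 hq20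
  · rw [show ((-(r * q ^ 2) : ℤ) : ZMod p) = (((-(r : ℤ)) : ℤ) : ZMod p) * ((q : ℤ) : ZMod p) ^ 2 by push_cast; ring]
    exact not_isSquare_mul_of_isSquare hnr hq2 hq20
  · rw [show ((4 * r ^ 2 * q : ℤ) : ZMod p) = ((q : ℤ) : ZMod p) * ((r : ℤ) : ZMod p) ^ 2 * ((4 : ℤ) : ZMod p) by push_cast; ring]
    exact not_isSquare_mul_of_isSquare (not_isSquare_mul_of_isSquare hnq hr2 hr20) h4 h40
  · rw [show ((4 * r * q : ℤ) : ZMod p) = ((r * q : ℤ) : ZMod p) * ((4 : ℤ) : ZMod p) by push_cast; ring]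
    exact not_isSquare_mul_of_isSquare hrq h4 h40
  · rw [show ((2 * q : ℤ) : ZMod p) = ((q : ℤ) : ZMod p) * ((2 : ℤ) : ZMod p) by push_cast; ring]
    exact not_isSquare_mul_of_isSquare hnq h2 h20
  · rw [show ((2 * r ^ 2 * q : ℤ) : ZMod p) = ((q : ℤ) : ZMod p) * ((r : ℤ) : ZMod p) ^ 2 * ((2 : ℤ) : ZMod p) by push_cast; ring]
    exact not_isSquare_mul_of_isSquare (not_isSquare_mul_of_isSquare hnq hr2 hr20) h2 h20
  · rw [show ((2 * r * q : ℤ) : ZMod p) = ((r * q : ℤ) : ZMod p) * ((2 : ℤ) : ZMod p) by push_cast; ring]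
    exact not_isSquare_mul_of_isSquare hrq h2 h20

omit hp hq in
/-- **Anisotropy modulo the partner**: if `p` is not a fourth power mod `r` and `r ∤ q`, the reduced forms `−q·x⁴ + pq·y⁴` and
`pq·x⁴ − q·y⁴` have no non-trivial zero mod `r` (a zero with `y ≠ 0`, resp. `x ≠ 0`, exhibits `p` as a fourth power). [folklore] -/
theorem anisotropic_mod_partner (hq0 : ((q : ℤ) : ZMod r) ≠ 0) (hp4 : ∀ t : ZMod r, t ^ 4 ≠ ((p : ℤ) : ZMod r)) :
    (∀ x y : ZMod r, ((-(q : ℤ) : ℤ) : ZMod r) * x ^ 4 + (((p : ℤ) * q : ℤ) : ZMod r) * y ^ 4 = 0 → x = 0 ∧ y = 0) ∧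
    (∀ x y : ZMod r, (((p : ℤ) * q : ℤ) : ZMod r) * x ^ 4 + ((-(q : ℤ) : ℤ) : ZMod r) * y ^ 4 = 0 → x = 0 ∧ y = 0) := by
  have key : ∀ x y : ZMod r, x ^ 4 = ((p : ℤ) : ZMod r) * y ^ 4 → x = 0 ∧ y = 0 := by
    intro x y h
    by_cases hy : y = 0
    · rw [hy, zero_pow four_ne_zero, mul_zero] at h
      exact ⟨pow_eq_zero_iff four_ne_zero |>.mp h, hy⟩
    · exfalso
      apply hp4 (x / y)
      rw [div_pow, h, mul_div_assoc, div_self (pow_ne_zero 4 hy), mul_one]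
  push_cast
  constructor
  · intro x y h
    exact key x y (by
      have h' : ((q : ℤ) : ZMod r) * (x ^ 4 - ((p : ℤ) : ZMod r) * y ^ 4) = 0 := by
        push_cast; linear_combination -h
      rcases mul_eq_zero.mp h' with h0 | h0
      · exact absurd (by exact_mod_cast h0) hq0
      · linear_combination h0)
  · intro x y h
    have := key y x (by
      have h' : ((q : ℤ) : ZMod r) * (y ^ 4 - ((p : ℤ) : ZMod r) * x ^ 4) = 0 := by
        push_cast; linear_combination -h
      rcases mul_eq_zero.mp h' with h0 | h0
      · exact absurd (by exact_mod_cast h0) hq0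
      · linear_combination h0)
    exact ⟨this.2, this.1⟩

end Residues

/-! ## §2 The side `S(0, −r²pq²) = {1, −p}` -/

section SSide

variable {p q r : ℕ} [hp : Fact p.Prime] [hq : Fact q.Prime] [hr : Fact r.Prime]

/-- The squarefree divisors of `r²·p·q²`: absolute values among `1, r, p, rp, q, rq, pq, rpq`. [folklore] -/
theorem natAbs_eq_of_squarefree_dvd_partner {d : ℤ} (hsq : Squarefree d) (hdvd : d ∣ (r ^ 2 * p * q ^ 2 : ℤ)) :
    d.natAbs = 1 ∨ d.natAbs = r ∨ d.natAbs = p ∨ d.natAbs = r * p ∨ d.natAbs = q ∨ d.natAbs = r * q ∨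
      d.natAbs = p * q ∨ d.natAbs = r * (p * q) := by
  set m := d.natAbs with hm_def
  have hmsq : Squarefree m := Int.squarefree_natAbs.mpr hsq
  have hm1 : m ∣ r ^ 2 * p * q ^ 2 := by
    have h1 := Int.natAbs_dvd_natAbs.mpr hdvd
    have h2 : (r ^ 2 * p * q ^ 2 : ℤ).natAbs = r ^ 2 * p * q ^ 2 := by
      rw [show (r ^ 2 * p * q ^ 2 : ℤ) = ((r ^ 2 * p * q ^ 2 : ℕ) : ℤ) by push_cast; ring, Int.natAbs_natCast]
    rwa [h2] at h1
  have hm2 : m ∣ (r * (p * q)) ^ 2 := dvd_trans hm1 ⟨p, by ring⟩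
  have hm3 : m ∣ r * (p * q) := (hmsq.dvd_pow_iff_dvd two_ne_zero).mp hm2
  obtain ⟨a, b, ha, hb, hm⟩ := exists_dvd_and_dvd_of_dvd_mul hm3
  obtain ⟨b₁, b₂, hb₁, hb₂, rfl⟩ := exists_dvd_and_dvd_of_dvd_mul hb
  rcases (Nat.dvd_prime hr.out).mp ha with ha' | ha' <;>
  rcases (Nat.dvd_prime hp.out).mp hb₁ with h1 | h1 <;>
  rcases (Nat.dvd_prime hq.out).mp hb₂ with h2 | h2 <;>
  · rw [hm, ha', h1, h2]; simp

omit hp hq hr in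
/-- **The four `2`-adic kills** (`r ≡ 5`, `p ≡ 7`, `q ≡ 3 (mod 8)`; no solutions modulo `8`): the classes `−q`, `−rp`, `pq`, `r`
of `S(0, −r²pq²)`. [cite: SilvermanAEC2009, proof of Prop. X.6.2(b)] -/
theorem two_adic_kills_partner (hr8 : r % 8 = 5) (hp8 : p % 8 = 7) (hq8 : q % 8 = 3) :
    ¬ ((twoIsogenyQuartic 0 (-(q : ℤ)) (r ^ 2 * p * q)).map (Int.castRingHom ℚ_[2])).IsSoluble ∧
    ¬ ((twoIsogenyQuartic 0 (-(r * p : ℤ)) (r * q ^ 2)).map (Int.castRingHom ℚ_[2])).IsSoluble ∧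
    ¬ ((twoIsogenyQuartic 0 ((p : ℤ) * q) (-(r ^ 2 * q : ℤ))).map (Int.castRingHom ℚ_[2])).IsSoluble ∧
    ¬ ((twoIsogenyQuartic 0 (r : ℤ) (-(r * p * q ^ 2 : ℤ))).map (Int.castRingHom ℚ_[2])).IsSoluble := by
  have hp' : (p : ZMod 8) = 7 := by simpa using natCast_zmod8_of_mod hp8 (by norm_num)
  have hq' : (q : ZMod 8) = 3 := by simpa using natCast_zmod8_of_mod hq8 (by norm_num)
  have hr' : (r : ZMod 8) = 5 := by simpa using natCast_zmod8_of_mod hr8 (by norm_num)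
  refine ⟨not_isSoluble_two_of_zmod8 ?_, not_isSoluble_two_of_zmod8 ?_, not_isSoluble_two_of_zmod8 ?_,
    not_isSoluble_two_of_zmod8 ?_⟩ <;>
  · push_cast
    rw [hp', hq', hr']
    decide

omit hp hq in
/-- **The two kills at the partner** (`p ∉ 𝔽_r^{×4}`): the classes `−rq` and `rpq` of `S(0, −r²pq²)`.
[cite: SilvermanAEC2009, proof of Prop. X.6.2(b)] -/
theorem partner_kills (hq0 : ((q : ℤ) : ZMod r) ≠ 0) (hp4 : ∀ t : ZMod r, t ^ 4 ≠ ((p : ℤ) : ZMod r)) :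
    ¬ ((twoIsogenyQuartic 0 (-(r * q : ℤ)) (r * p * q)).map (Int.castRingHom ℚ_[r])).IsSoluble ∧
    ¬ ((twoIsogenyQuartic 0 (r * ((p : ℤ) * q)) (-(r * q : ℤ))).map (Int.castRingHom ℚ_[r])).IsSoluble := by
  obtain ⟨k1, k2⟩ := anisotropic_mod_partner (p := p) (q := q) (r := r) hq0 hp4
  constructor
  · exact not_isSoluble_padic_of_dvd_of_dvd (ℓ := r) (c := -(r * q : ℤ)) (c' := r * p * q)
      (c₀ := -(q : ℤ)) (c₀' := (p : ℤ) * q) (by ring) (by ring) k1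
  · exact not_isSoluble_padic_of_dvd_of_dvd (ℓ := r) (c := (r * ((p : ℤ) * q))) (c' := -(r * q : ℤ))
      (c₀ := (p : ℤ) * q) (c₀' := -(q : ℤ)) (by ring) (by ring) k2

/-- ★ **`S(0, −r²pq²) = {1, −p}`** for primes `p ≡ 7 (mod 8)`, `q ≡ 3 (mod 8)`, `r ≡ 5 (mod 8)` with `(q/p) = −1`, `(r/p) = +1` and
`p` not a fourth power modulo `r`: descent on the divisors of `b = −r²pq²` for the twist `W_p⁻^{(−rq)} : y² = x³ − r²pq²·x`.
[cite: SilvermanAEC2009, Prop. X.4.9 and Prop. X.6.1] -/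
theorem mem_selmer_neg_iff (hp8 : p % 8 = 7) (hq8 : q % 8 = 3) (hr8 : r % 8 = 5)
    (hnq : ¬ IsSquare ((q : ℤ) : ZMod p)) (hsr : IsSquare ((r : ℤ) : ZMod p))
    (hp4 : ∀ t : ZMod r, t ^ 4 ≠ ((p : ℤ) : ZMod r)) (d : ℤ) :
    d ∈ twoIsogenySelmerGroup 0 (-(r ^ 2 * p * q ^ 2 : ℤ)) ↔ d = 1 ∨ d = -(p : ℤ) := by
  have hP := hp.out
  have hQ := hq.out
  have hR := hr.out
  have hqp : q ≠ p := by rintro rfl; omega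
  have hrp : r ≠ p := by rintro rfl; omega
  have hrq : r ≠ q := by rintro rfl; omega
  have hp0 : (p : ℤ) ≠ 0 := by exact_mod_cast hP.ne_zero
  have hq0 : (q : ℤ) ≠ 0 := by exact_mod_cast hQ.ne_zero
  have hr0 : (r : ℤ) ≠ 0 := by exact_mod_cast hR.ne_zero
  have hb : (-(r ^ 2 * p * q ^ 2 : ℤ)) ≠ 0 :=
    neg_ne_zero.mpr (mul_ne_zero (mul_ne_zero (pow_ne_zero 2 hr0) hp0) (pow_ne_zero 2 hq0))
  have hpq : ¬ (p : ℤ) ∣ q := fun h => hqp (((Nat.prime_dvd_prime_iff_eq hP hQ).mp (by exact_mod_cast h))).symm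
  have hpr : ¬ (p : ℤ) ∣ r := fun h => hrp (((Nat.prime_dvd_prime_iff_eq hP hR).mp (by exact_mod_cast h))).symm
  have hpI : Prime (p : ℤ) := Nat.prime_iff_prime_int.mp hP
  have hnd : ∀ m : ℤ, ¬ (p : ℤ) ∣ m → ¬ (p : ℤ) ^ 2 ∣ (p : ℤ) * m := fun m hm => not_sq_dvd_mul_of_not_dvd hm
  have hp1 : ¬ (p : ℤ) ∣ 1 := fun h =>
    hP.one_lt.ne' (by exact_mod_cast Int.eq_one_of_dvd_one (by positivity) h)
  -- `p ∤ r²q², rq², r²q, rq`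
  have hnr2q2 : ¬ (p : ℤ) ∣ r ^ 2 * q ^ 2 := fun h => by
    rcases hpI.dvd_or_dvd h with h | h
    · exact hpr (hpI.dvd_of_dvd_pow h)
    · exact hpq (hpI.dvd_of_dvd_pow h)
  have hnrq2 : ¬ (p : ℤ) ∣ r * q ^ 2 := fun h => by
    rcases hpI.dvd_or_dvd h with h | h
    · exact hpr h
    · exact hpq (hpI.dvd_of_dvd_pow h)
  have hnr2q : ¬ (p : ℤ) ∣ r ^ 2 * q := fun h => by
    rcases hpI.dvd_or_dvd h with h | h
    · exact hpr (hpI.dvd_of_dvd_pow h)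
    · exact hpq h
  have hnrq : ¬ (p : ℤ) ∣ r * q := fun h => by
    rcases hpI.dvd_or_dvd h with h | h
    · exact hpr h
    · exact hpq h
  have hm1 := not_isSquare_neg_one (p := p) (by omega)
  obtain ⟨hmr, hrqn, hr2q, hmr2q2, hmrq2, -, -, -, -, -⟩ := nonresidues_mod_p_partner hp8 hqp hrp hQ hR hnq hsr
  haveI : Fact (Nat.Prime 2) := ⟨Nat.prime_two⟩
  have hqr0 : ((q : ℤ) : ZMod r) ≠ 0 := by
    intro h0
    have : (r : ℤ) ∣ q := (ZMod.intCast_zmod_eq_zero_iff_dvd q r).mp h0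
    have : r ∣ q := by exact_mod_cast this
    exact hrq ((Nat.prime_dvd_prime_iff_eq hR hQ).mp this)
  obtain ⟨k1, k2, k3, k4⟩ := two_adic_kills_partner (p := p) (q := q) (r := r) hr8 hp8 hq8
  obtain ⟨f1, f2⟩ := partner_kills (p := p) (q := q) (r := r) hqr0 hp4
  constructor
  · intro hd
    have hsq := squarefree_of_mem_twoIsogenySelmerGroup hd
    have hd0 : d ≠ 0 := hsq.ne_zero
    have hdvd : d ∣ (r ^ 2 * p * q ^ 2 : ℤ) := dvd_neg.mp (dvd_of_mem_twoIsogenySelmerGroup hd)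
    have key : ∀ d' : ℤ, d * d' = -(r ^ 2 * p * q ^ 2 : ℤ) → (twoIsogenyQuartic 0 d d').IsLocallySoluble :=
      fun d' hdd => isLocallySoluble_of_mem hd0 hdd hd
    rcases natAbs_eq_of_squarefree_dvd_partner (p := p) (q := q) (r := r) hsq hdvd with h | h | h | h | h | h | h | h <;>
      rcases Int.natAbs_eq d with hd' | hd' <;> rw [h] at hd' <;> push_cast at hd' <;> subst hd'
    · exact Or.inl rfl
    · -- d = -1 : dies at p
      refine absurd ((key (r ^ 2 * p * q ^ 2) (by ring)).2 p) ?_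
      exact not_isSoluble_padic_of_dvd_right (c := -1) (c' := r ^ 2 * p * q ^ 2) ⟨r ^ 2 * q ^ 2, by ring⟩
        (by rw [show (r ^ 2 * p * q ^ 2 : ℤ) = p * (r ^ 2 * q ^ 2) by ring]; exact hnd _ hnr2q2) hm1
    · -- d = r : dies at 2
      exact absurd ((key (-(r * p * q ^ 2)) (by ring)).2 2) k4
    · -- d = -r : dies at p
      refine absurd ((key (r * p * q ^ 2) (by ring)).2 p) ?_
      exact not_isSoluble_padic_of_dvd_right (c := -(r : ℤ)) (c' := r * p * q ^ 2) ⟨r * q ^ 2, by ring⟩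
        (by rw [show (r * p * q ^ 2 : ℤ) = p * (r * q ^ 2) by ring]; exact hnd _ hnrq2) hmr
    · -- d = p : dies at p
      refine absurd ((key (-(r ^ 2 * q ^ 2)) (by ring)).2 p) ?_
      exact not_isSoluble_padic_of_dvd_left (c := (p : ℤ)) (c' := -(r ^ 2 * q ^ 2)) (dvd_refl _)
        (by simpa using hnd 1 hp1) hmr2q2
    · exact Or.inr rfl
    · -- d = rp : dies at p
      refine absurd ((key (-(r * q ^ 2)) (by ring)).2 p) ?_
      exact not_isSoluble_padic_of_dvd_left (c := (r : ℤ) * p) (c' := -(r * q ^ 2)) ⟨r, by ring⟩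
        (by rw [show ((r : ℤ) * p) = p * r by ring]; exact hnd r hpr) hmrq2
    · -- d = -rp : dies at 2
      exact absurd ((key (r * q ^ 2) (by ring)).2 2) k2
    · -- d = q : dies at p
      refine absurd ((key (-(r ^ 2 * p * q)) (by ring)).2 p) ?_
      exact not_isSoluble_padic_of_dvd_right (c := (q : ℤ)) (c' := -(r ^ 2 * p * q)) ⟨-(r ^ 2 * q), by ring⟩
        (by rw [show (-(r ^ 2 * p * q) : ℤ) = p * (-(r ^ 2 * q)) by ring]; exact hnd _ (by rwa [dvd_neg])) hnq
    · -- d = -q : dies at 2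
      exact absurd ((key (r ^ 2 * p * q) (by ring)).2 2) k1
    · -- d = rq : dies at p
      refine absurd ((key (-(r * p * q)) (by ring)).2 p) ?_
      exact not_isSoluble_padic_of_dvd_right (c := (r : ℤ) * q) (c' := -(r * p * q)) ⟨-(r * q), by ring⟩
        (by rw [show (-(r * p * q) : ℤ) = p * (-(r * q)) by ring]; exact hnd _ (by rwa [dvd_neg])) hrqn
    · -- d = -rq : dies at r
      exact absurd ((key (r * p * q) (by ring)).2 r) f1
    · -- d = pq : dies at 2
      exact absurd ((key (-(r ^ 2 * q)) (by ring)).2 2) k3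
    · -- d = -pq : dies at p
      refine absurd ((key (r ^ 2 * q) (by ring)).2 p) ?_
      exact not_isSoluble_padic_of_dvd_left (c := -((p : ℤ) * q)) (c' := r ^ 2 * q) ⟨-q, by ring⟩
        (by rw [show (-((p : ℤ) * q)) = p * (-q) by ring]; exact hnd _ (by rwa [dvd_neg])) hr2q
    · -- d = rpq : dies at r
      exact absurd ((key (-(r * q)) (by ring)).2 r) f2
    · -- d = -rpq : dies at p
      refine absurd ((key (r * q) (by ring)).2 p) ?_
      exact not_isSoluble_padic_of_dvd_left (c := -((r : ℤ) * (p * q))) (c' := r * q) ⟨-(r * q), by ring⟩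
        (by rw [show (-((r : ℤ) * (p * q))) = p * (-(r * q)) by ring]; exact hnd _ (by rwa [dvd_neg])) hrqn
  · rintro (rfl | rfl)
    · exact one_mem_twoIsogenySelmerGroup 0 hb
    · refine mem_twoIsogenySelmerGroup_of_isSquare hb ?_ ⟨r ^ 2 * q ^ 2, by ring⟩ ⟨r * q, ?_⟩
      · exact Int.squarefree_natAbs.mp (by rw [Int.natAbs_neg, Int.natAbs_natCast]; exact hP.prime.squarefree)
      · rw [show (-(r ^ 2 * p * q ^ 2 : ℤ)) = -(p : ℤ) * (r ^ 2 * q ^ 2) by ring,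
          Int.mul_ediv_cancel_left _ (neg_ne_zero.mpr hp0)]
        ring

end SSide

end Summit.BirchSwinnertonDyer.BirchSwinnertonDyer.Theorems.BiquadraticEisensteinDescentHeegnerTwistCouplingInSupplyQuarticPartnerDescent

end
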